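import Mathlib
import Summits.Ventures.PercRepro2.TypedMarkedSeriesDefs
import Summits.Ventures.PercRepro2.TypedMarkedSeries
import Summits.Ventures.PercRepro2.TypedPositiveOB

/-!
# Marked STAR vertices of degree three: the generic positivity theorem (blind cell PercRepro2,
night-3 g14, 2026-08-27; `proofs/NIGHT3-CERT.md` §23.10)

A mark `w` of degree three whose three typed edges `e₁, e₂, e₃` lead to three other marks: with the
three edges closed `w` is isolated and the state of a copy is a function (a «model», three bits) of
the six-bit signature of the other four marks.  Splitting the typed count at the three edges
(`typedCount_split`, three times) and moving the guarded sums inside, six times the typed base is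
the typed count of the 27-term colouring sum of the model at the signature triple of the copies
(`sum_split_eq_S27`): if that sum is nonnegative on every consistent signature triple, the typed
base is nonnegative (`typedCount_nonneg_of_model3`).  The 27-term sum is written out as nested
list sums over `cols` (no new definition).  Nothing here asserts anything about the original lane.
-/

namespace Summit.Ventures.PercRepro2

open UnionCluster

namespace CovForm

namespace MarkedSeries

open OneTyped TypedA3 Untouched TypedRed

section Assembly3

open Classical

variable {V : Type*} {E : Type*} [Fintype E] [DecidableEq E] {R : Type*} [Field R]
  [LinearOrder R] [IsStrictOrderedRing R]
variable (ends : E → Sym2 V) (o a₁ a₂ a₃ b : V)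

omit [Fintype E] [DecidableEq E] [LinearOrder R] [IsStrictOrderedRing R] in
/-- The 27-term colouring sum of a three-bit model, as the guarded Boolean sums of the three splits. -/
lemma sum_split_eq_S27 (k l m : ℕ) (hk : k = 1 ∨ k = 2) (hl : l = 1 ∨ l = 2) (hm : m = 1 ∨ m = 2)
    (m₁ m₂ m₃ : Bool → Bool → Bool → St) :
    (∑ u : Bool, ∑ v : Bool, ∑ t : Bool, if u.toNat + v.toNat + t.toNat = m then
      (∑ a : Bool, ∑ b' : Bool, ∑ c : Bool, if a.toNat + b'.toNat + c.toNat = l then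
        (∑ p : Bool, ∑ q : Bool, ∑ r : Bool, if p.toNat + q.toNat + r.toNat = k then
          ((KBsym (m₁ p a u) (m₂ q b' v) (m₃ r c t) : ℤ) : R) else 0) else 0) else 0) =
      ((((cols m).map fun uvt => ((cols l).map fun abc => ((cols k).map fun pqr =>
        KBsym (m₁ pqr.1 abc.1 uvt.1) (m₂ pqr.2.1 abc.2.1 uvt.2.1)
          (m₃ pqr.2.2 abc.2.2 uvt.2.2)).sum).sum).sum : ℤ) : R) := by
  rcases hk with rfl | rfl <;> rcases hl with rfl | rfl <;> rcases hm with rfl | rfl <;>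
    simp [cols] <;> ring

/-- **The generic marked-star positivity theorem** (three typed edges at a mark): given a model `md`
of the states of the copies from the six-bit signature of the configuration with the three edges
closed (`hst`, on the support), consistent signatures (`hcons`) and the nonnegativity of the 27-term
colouring sum of the model on consistent signature triples (`hid`), the typed base is nonnegative. -/
theorem typedCount_nonneg_of_model3 (F : Finset E) (z : Config E) (τ : E → ℕ)
    (hτ : ∀ e ∈ F, τ e = 1 ∨ τ e = 2) {e f g : E} (hef : e ≠ f) (heg : e ≠ g) (hfg : f ≠ g)
    (heF : e ∈ F) (hfF : f ∈ F) (hgF : g ∈ F)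
    (md : Bool → Bool → Bool → Bool → Bool → Bool → Bool → Bool → Bool → St)
    (s1 s2 s3 s4 s5 s6 : Config E → Bool)
    (hcons : ∀ x, consB (s1 x) (s2 x) (s3 x) (s4 x) (s5 x) (s6 x) = true)
    (hst : ∀ x : Config E, (∀ e', e' ∉ ((F.erase g).erase f).erase e →
        x e' = Function.update (Function.update (Function.update z g false) f false) e false e') →
      ∀ p a u : Bool,
      st ends o a₁ a₂ a₃ b (Function.update (Function.update (Function.update x e p) f a) g u) =
        md (s1 x) (s2 x) (s3 x) (s4 x) (s5 x) (s6 x) p a u)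
    (hid : ∀ k l m : ℕ, (k = 1 ∨ k = 2) → (l = 1 ∨ l = 2) → (m = 1 ∨ m = 2) →
      ∀ c1 c2 c3 c4 c5 c6 : Bool, consB c1 c2 c3 c4 c5 c6 = true →
      ∀ d1 d2 d3 d4 d5 d6 : Bool, consB d1 d2 d3 d4 d5 d6 = true →
      ∀ e1 e2 e3 e4 e5 e6 : Bool, consB e1 e2 e3 e4 e5 e6 = true →
      0 ≤ (((cols m).map fun uvt => ((cols l).map fun abc => ((cols k).map fun pqr =>
        KBsym (md c1 c2 c3 c4 c5 c6 pqr.1 abc.1 uvt.1) (md d1 d2 d3 d4 d5 d6 pqr.2.1 abc.2.1 uvt.2.1)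
          (md e1 e2 e3 e4 e5 e6 pqr.2.2 abc.2.2 uvt.2.2)).sum).sum).sum : ℤ)) :
    0 ≤ typedCount F z τ (K3 ends o a₁ a₂ a₃ b : Config E → Config E → Config E → R) := by
  have h6 := six_mul_typedCount_KBsym (R := R) ends o a₁ a₂ a₃ b F z τ hτ
  have hfF' : f ∈ F.erase g := Finset.mem_erase.2 ⟨hfg, hfF⟩
  have heF' : e ∈ (F.erase g).erase f := Finset.mem_erase.2 ⟨hef, Finset.mem_erase.2 ⟨heg, heF⟩⟩
  have hk := hτ e heF
  have hl := hτ f hfF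
  have hm := hτ g hgF
  set F₀ := ((F.erase g).erase f).erase e with hF₀
  set z₀ := Function.update (Function.update (Function.update z g false) f false) e false with hz₀
  have hsplit : typedCount F z τ (fun x y w => ((KBsym (st ends o a₁ a₂ a₃ b x)
      (st ends o a₁ a₂ a₃ b y) (st ends o a₁ a₂ a₃ b w) : ℤ) : R)) =
      ∑ u : Bool, ∑ v : Bool, ∑ t : Bool, if u.toNat + v.toNat + t.toNat = τ g then
        (∑ a : Bool, ∑ b' : Bool, ∑ c : Bool, if a.toNat + b'.toNat + c.toNat = τ f then
          (∑ p : Bool, ∑ q : Bool, ∑ r : Bool, if p.toNat + q.toNat + r.toNat = τ e then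
            typedCount F₀ z₀ τ
              (fun x y w => ((KBsym (md (s1 x) (s2 x) (s3 x) (s4 x) (s5 x) (s6 x) p a u)
                (md (s1 y) (s2 y) (s3 y) (s4 y) (s5 y) (s6 y) q b' v)
                (md (s1 w) (s2 w) (s3 w) (s4 w) (s5 w) (s6 w) r c t) : ℤ) : R)) else 0) else 0)
        else 0 := by
    rw [typedCount_split F g hgF]
    refine Finset.sum_congr rfl fun u _ => Finset.sum_congr rfl fun v _ =>
      Finset.sum_congr rfl fun t _ => ?_
    refine if_congr Iff.rfl ?_ rfl
    rw [typedCount_split (F.erase g) f hfF']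
    refine Finset.sum_congr rfl fun a _ => Finset.sum_congr rfl fun b' _ =>
      Finset.sum_congr rfl fun c _ => ?_
    refine if_congr Iff.rfl ?_ rfl
    rw [typedCount_split ((F.erase g).erase f) e heF']
    refine Finset.sum_congr rfl fun p _ => Finset.sum_congr rfl fun q _ =>
      Finset.sum_congr rfl fun r _ => ?_
    refine if_congr Iff.rfl ?_ rfl
    refine typedCount_congr_on_support _ _ _ fun x y w hxyw _ => ?_
    rw [hst x (fun e' he' => (hxyw e' he').1) p a u, hst y (fun e' he' => (hxyw e' he').2.1) q b' v,
      hst w (fun e' he' => (hxyw e' he').2.2) r c t]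
  have hin : (∑ u : Bool, ∑ v : Bool, ∑ t : Bool, if u.toNat + v.toNat + t.toNat = τ g then
        (∑ a : Bool, ∑ b' : Bool, ∑ c : Bool, if a.toNat + b'.toNat + c.toNat = τ f then
          (∑ p : Bool, ∑ q : Bool, ∑ r : Bool, if p.toNat + q.toNat + r.toNat = τ e then
            typedCount F₀ z₀ τ
              (fun x y w => ((KBsym (md (s1 x) (s2 x) (s3 x) (s4 x) (s5 x) (s6 x) p a u)
                (md (s1 y) (s2 y) (s3 y) (s4 y) (s5 y) (s6 y) q b' v)
                (md (s1 w) (s2 w) (s3 w) (s4 w) (s5 w) (s6 w) r c t) : ℤ) : R)) else 0) else 0)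
        else 0) =
      typedCount F₀ z₀ τ (fun x y w =>
        ∑ u : Bool, ∑ v : Bool, ∑ t : Bool, if u.toNat + v.toNat + t.toNat = τ g then
          (∑ a : Bool, ∑ b' : Bool, ∑ c : Bool, if a.toNat + b'.toNat + c.toNat = τ f then
            (∑ p : Bool, ∑ q : Bool, ∑ r : Bool, if p.toNat + q.toNat + r.toNat = τ e then
              ((KBsym (md (s1 x) (s2 x) (s3 x) (s4 x) (s5 x) (s6 x) p a u)
                (md (s1 y) (s2 y) (s3 y) (s4 y) (s5 y) (s6 y) q b' v)
                (md (s1 w) (s2 w) (s3 w) (s4 w) (s5 w) (s6 w) r c t) : ℤ) : R) else 0) else 0)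
          else 0) := by
    simp only [typedCount_sum_ite, typedCount_sum]
  have hnn : 0 ≤ typedCount F₀ z₀ τ (fun x y w =>
        ∑ u : Bool, ∑ v : Bool, ∑ t : Bool, if u.toNat + v.toNat + t.toNat = τ g then
          (∑ a : Bool, ∑ b' : Bool, ∑ c : Bool, if a.toNat + b'.toNat + c.toNat = τ f then
            (∑ p : Bool, ∑ q : Bool, ∑ r : Bool, if p.toNat + q.toNat + r.toNat = τ e then
              ((KBsym (md (s1 x) (s2 x) (s3 x) (s4 x) (s5 x) (s6 x) p a u)
                (md (s1 y) (s2 y) (s3 y) (s4 y) (s5 y) (s6 y) q b' v)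
                (md (s1 w) (s2 w) (s3 w) (s4 w) (s5 w) (s6 w) r c t) : ℤ) : R) else 0) else 0)
          else 0) := by
    refine PositiveOB.typedCount_nonneg_of_nonneg_on_support _ _ _ fun x y w _ _ => ?_
    rw [sum_split_eq_S27 (τ e) (τ f) (τ g) hk hl hm]
    exact_mod_cast hid (τ e) (τ f) (τ g) hk hl hm _ _ _ _ _ _ (hcons x) _ _ _ _ _ _ (hcons y)
      _ _ _ _ _ _ (hcons w)
  rw [hsplit, hin] at h6
  rw [← h6] at hnn
  exact (mul_nonneg_iff_of_pos_left (by norm_num : (0 : R) < 6)).1 hnn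

end Assembly3

end MarkedSeries

end CovForm

end Summit.Ventures.PercRepro2
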